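import Literature.MathematicalPhysics.QuantumFieldTheory.Balaban1983to89.B11Eq90V0Derivative

/-!
# `Balaban1983to89.B11Eq90StB` — T. Bałaban, *The variational problem and background fields in renormalization group method for lattice gauge theories*, Commun. Math. Phys. **102** (1985) 277–309 [Balaban1985Variational]: p. 291, (90) «where st(b) denotes a set of plaquettes p such that b ⊂ ∂p» — THE SET `st(b)` ON [5]'S ABSTRACT LATTICE, its count `#st(b) ≦ 2(d − 1)`, and the ONE-BOND form «(∂/∂A(b))» of the V₀-group bound of `B11Eq90V0Derivative`

statement-level skeleton of published theorems with citation tags; proofs where landed; nothing here is a claim about the Yang–Mills mass gap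

PDF held: `paper:balaban1985-cmp102-variational-background` (journal page = PDF page + 276); p. 291 read by this seat from the `lit read` text layer;
(90) as transcribed (render-read) in `B11Eq85FirstDerivative`.

CITATION HEADER (lean-in-tree rule 2026-08-18).  WHAT IS REPRODUCED: the clause of (90) defining `st(b)` and the coordinate form
`(∂/∂A(b))` of the functional derivative (one bond variable), on the carrier of `B9Eq39Adjoint` / `B11Eq26ActionExpansion` (sites `S`,
directions `ι`, bijective shifts `T μ`; the plaquette `p_{μν}(x)`, `μ < ν`, has the boundary bonds `(μ, x)`, `(ν, T_μ x)`, `(μ, T_ν x)`, `(ν, x)`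
— the four letters of `B9Eq39Adjoint.lettersA`).  THE PRINT, verbatim (p. 291): *«… = Σ_{p∈st(b)} ((∂/∂A(b))V′₀)(A′ − HD(A′), ∂p) − …, (90)
where st(b) denotes a set of plaquettes p such that b ⊂ ∂p.»*; p. 292 uses `#st(b) = 2(d − 1)` implicitly in every «O(1)» of
(90)–(96) (cf. `B11Eq93Commutator`: «print's O(1) are certified as 8(d − 1), 16(d − 1), 24(d − 1)»).

WHAT IS CERTIFIED (kernel, sorry-free; axioms `propext` / `Classical.choice` / `Quot.sound`).
§1 `bondDelta μ₀ x₀ X` — the variation `δA` supported on the single bond `b = (μ₀, x₀)` with value `X` («∂/∂A(b)»); `st T μ₀ x₀` — the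
   positively oriented plaquettes whose boundary contains `b` (a `Finset`, decidable on the data); **`lettersA_bondDelta_of_not_mem_st`**
   (a plaquette outside `st(b)` has boundary letters blind to `δA` — the hypothesis `hP` of `B11Eq90V0Derivative.deriv_V0_line_eq_sum_of_subset`);
   `st_subset_image`, **`card_st_le`**: `#st(b) ≦ 2(|ι| − 1)` (= `2(d − 1)` on the torus: for each direction `κ ≠ μ₀` the two plaquettes
   `p_{μ₀κ}(x₀)`, `p_{μ₀κ}(T_κ⁻¹x₀)`).
§2 **`deriv_V0_bond_eq_sum_st`** — (90)'s first display in coordinates: `(∂/∂A(b))V₀(A)·X = η^d Σ_{p∈st(b)} (∂/∂A(b))V₀(A, ∂p)·X`;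
   **`norm_deriv_V0_bond_le`** — the V₀-group bound PER BOND: `|(∂/∂A(b))V₀(A)·X| ≦ η^d · 2(|ι| − 1) · (4/3)κη⁻¹s²e^{2ηs}·Δ` under the
   uniform majorants of `B11Eq90V0Derivative.norm_deriv_V0_line_le` on `st(b)` (`|A|(∂p) ≦ s`, the size of `δA`'s letters `≦ Δ` — for a unitary
   background `Δ = ‖X‖` —, `½‖τ‖(‖U₀(∂p)‖ + ‖U₀(∂p)⁻¹‖) ≦ κ`).

HONEST SCOPE — what is NOT claimed.  (i) Abstract carrier: `2(|ι| − 1)` is an upper bound from the bijectivity of the shifts alone (on a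
degenerate `(S, T)` plaquettes may coincide; the bound still holds); the identification `|ι| = d` and `Ω_j`-localisation are the reader's
(DIVERGENCE D-pv27.4 inherited).  (ii) `V₀` in place of `V′₀ ∘ (A′ − HD(A′))`, exactly as in `B11Eq90V0Derivative` §4; the second sum of (90)
is not touched; the bound inherits the bare `η⁻¹` of `norm_V0p_le_cubic` (correct, not η-uniform — the η-uniform statement is the V′₀ one of
`B11Eq36Complex.norm_deriv_V0prime_line_le`).  (iii) Three plumbing `def`s (`bondDelta`, `st`, `stCover`), no `Prop`-valued definition, no new named fact.  Unit
`b2b-balaban-t4-ne9-formalise-leaf-05` (cell `pub-balaban`, NE9 crux-team leaf prover, gen 63; third file of the (L3)/V₀-group line).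
Imports `B11Eq90V0Derivative` ONLY.
-/

noncomputable section

open NormedSpace Complex Finset

namespace Literature.MathematicalPhysics.QuantumFieldTheory.Balaban1983to89.B11Eq90StB

open Literature.MathematicalPhysics.QuantumFieldTheory.Balaban1983to89
open Literature.MathematicalPhysics.QuantumFieldTheory.Balaban1983to89.Beta.TransportVertices
open Literature.MathematicalPhysics.QuantumFieldTheory.Balaban1983to89.B9Eq39Adjoint
open Literature.MathematicalPhysics.QuantumFieldTheory.Balaban1983to89.B11Eq26ActionExpansion
open Literature.MathematicalPhysics.QuantumFieldTheory.Balaban1983to89.B11Eq90V0Derivative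

/-! ## §1 The one-bond variation and `st(b)` -/

section StB

variable {𝔸 : Type*} [Ring 𝔸]
variable {S : Type*} [DecidableEq S] {ι : Type*} [LinearOrder ι]
variable (T : ι → Equiv.Perm S) (U : ι → S → 𝔸ˣ)

/-- The variation `δA` supported on the single bond `b = (μ₀, x₀)` with value `X` — the `∂/∂A(b)` of (90) is the derivative along it.
[cite: Balaban1985Variational, (90) p.291] -/
def bondDelta (μ₀ : ι) (x₀ : S) (X : 𝔸) : ι → S → 𝔸 := fun κ y => if κ = μ₀ ∧ y = x₀ then X else 0

variable [Fintype S] [Fintype ι]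

/-- **`st(b)`** «a set of plaquettes p such that b ⊂ ∂p» for `b = (μ₀, x₀)`: the positively oriented plaquettes `(y, μ′, ν′)`, `μ′ < ν′`,
one of whose four boundary bonds `(μ′, T_{ν′}y)`, `(ν′, y)`, `(μ′, y)`, `(ν′, T_{μ′}y)` is `b`. [cite: Balaban1985Variational, (90) p.291] -/
def st (μ₀ : ι) (x₀ : S) : Finset (S × ι × ι) :=
  (posPlaq S ι).filter fun q =>
    (q.2.1 = μ₀ ∧ (T q.2.2 q.1 = x₀ ∨ q.1 = x₀)) ∨ (q.2.2 = μ₀ ∧ (q.1 = x₀ ∨ T q.2.1 q.1 = x₀))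

/-- `st(b)` consists of positively oriented plaquettes. [cite: Balaban1985Variational, (90) p.291] -/
theorem st_subset_posPlaq (μ₀ : ι) (x₀ : S) : st T μ₀ x₀ ⊆ posPlaq S ι := Finset.filter_subset _ _

/-- **A plaquette outside `st(b)` has boundary letters blind to the one-bond variation** — the hypothesis `hP` of
`B11Eq90V0Derivative.deriv_V0_line_eq_sum_of_subset` / `norm_deriv_V0_line_le` at `P := st(b)`. [cite: Balaban1985Variational, (90) p.291] -/
theorem lettersA_bondDelta_of_not_mem_st (μ₀ : ι) (x₀ : S) (X : 𝔸) (q : S × ι × ι) (hq : q ∈ posPlaq S ι)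
    (h : q ∉ st T μ₀ x₀) :
    lettersA T U (bondDelta μ₀ x₀ X) q.2.1 q.2.2 q.1 = [0, 0, 0, 0] := by
  have h' : ¬ ((q.2.1 = μ₀ ∧ (T q.2.2 q.1 = x₀ ∨ q.1 = x₀)) ∨ (q.2.2 = μ₀ ∧ (q.1 = x₀ ∨ T q.2.1 q.1 = x₀))) :=
    fun hh => h (Finset.mem_filter.2 ⟨hq, hh⟩)
  have h1 : ¬ (q.2.1 = μ₀ ∧ (T q.2.2 q.1 = x₀ ∨ q.1 = x₀)) := fun hh => h' (Or.inl hh)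
  have h2 : ¬ (q.2.2 = μ₀ ∧ (q.1 = x₀ ∨ T q.2.1 q.1 = x₀)) := fun hh => h' (Or.inr hh)
  simp only [lettersA, bondDelta]
  have e1 : (if q.2.1 = μ₀ ∧ (T q.2.2) q.1 = x₀ then X else 0) = 0 := by
    rw [if_neg]; rintro ⟨a, b⟩; exact h1 ⟨a, Or.inl b⟩
  have e2 : (if q.2.2 = μ₀ ∧ q.1 = x₀ then X else 0) = 0 := by
    rw [if_neg]; rintro ⟨a, b⟩; exact h2 ⟨a, Or.inl b⟩
  have e3 : (if q.2.1 = μ₀ ∧ q.1 = x₀ then X else 0) = 0 := by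
    rw [if_neg]; rintro ⟨a, b⟩; exact h1 ⟨a, Or.inr b⟩
  have e4 : (if q.2.2 = μ₀ ∧ (T q.2.1) q.1 = x₀ then X else 0) = 0 := by
    rw [if_neg]; rintro ⟨a, b⟩; exact h2 ⟨a, Or.inr b⟩
  simp [e1, e2, e3, e4, R]

omit [Fintype S] [Fintype ι] in
/-- The covering family of `st(b)`: for each direction `κ` and a Boolean, the candidate plaquette in the `(μ₀, κ)`-plane through `x₀`
(`true`) or through `T_κ⁻¹ x₀` (`false`). [cite: Balaban1985Variational, (90) p.291] -/
def stCover (μ₀ : ι) (x₀ : S) (p : ι × Bool) : S × ι × ι :=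
  if μ₀ < p.1 then ((if p.2 then x₀ else (T p.1).symm x₀), μ₀, p.1)
  else ((if p.2 then x₀ else (T p.1).symm x₀), p.1, μ₀)

/-- `st(b) ⊆ stCover({κ ≠ μ₀} × Bool)`. [cite: Balaban1985Variational, (90) p.291] -/
theorem st_subset_image (μ₀ : ι) (x₀ : S) :
    st T μ₀ x₀ ⊆ ((Finset.univ.filter fun κ : ι => κ ≠ μ₀) ×ˢ (Finset.univ : Finset Bool)).image (stCover T μ₀ x₀) := by
  rintro ⟨y, μ', ν'⟩ hq
  rw [st, Finset.mem_filter, mem_posPlaq] at hq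
  obtain ⟨hlt, hinc⟩ := hq
  simp only at hlt
  rw [Finset.mem_image]
  rcases hinc with ⟨hμ, hy⟩ | ⟨hν, hy⟩
  · simp only at hμ hy
    subst hμ
    refine ⟨(ν', decide (y = x₀)), ?_, ?_⟩
    · simp only [Finset.mem_product, Finset.mem_filter, Finset.mem_univ, true_and, and_true]
      exact ne_of_gt hlt
    · by_cases hyx : y = x₀
      · simp [stCover, hlt, hyx]
      · have hy' : (T ν').symm x₀ = y := by
          rcases hy with hy | hy
          · rw [← hy, Equiv.symm_apply_apply]
          · exact absurd hy hyx
        simp [stCover, hlt, hyx, hy']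
  · simp only at hν hy
    subst hν
    refine ⟨(μ', decide (y = x₀)), ?_, ?_⟩
    · simp only [Finset.mem_product, Finset.mem_filter, Finset.mem_univ, true_and, and_true]
      exact ne_of_lt hlt
    · have hlt' : ¬ ν' < μ' := not_lt.2 hlt.le
      by_cases hyx : y = x₀
      · simp [stCover, hlt', hyx]
      · have hy' : (T μ').symm x₀ = y := by
          rcases hy with hy | hy
          · exact absurd hy hyx
          · rw [← hy, Equiv.symm_apply_apply]
        simp [stCover, hlt', hyx, hy']

/-- **`#st(b) ≦ 2(|ι| − 1)`** — on the `d`-dimensional torus `2(d − 1)` plaquettes contain a given bond (the count behind every «O(1)» of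
(90)–(96)). [cite: Balaban1985Variational, (90) p.291] -/
theorem card_st_le (μ₀ : ι) (x₀ : S) : (st T μ₀ x₀).card ≤ 2 * (Fintype.card ι - 1) := by
  refine (Finset.card_le_card (st_subset_image T μ₀ x₀)).trans (Finset.card_image_le.trans ?_)
  rw [Finset.card_product, Finset.card_univ, Fintype.card_bool, Finset.filter_ne' Finset.univ μ₀,
    Finset.card_erase_of_mem (Finset.mem_univ _), Finset.card_univ]
  omega

end StB

/-! ## §2 The V₀-group bound per bond: «(∂/∂A(b))» -/

section Bound

variable {𝔸 : Type*} [NormedRing 𝔸] [NormedAlgebra ℂ 𝔸] [CompleteSpace 𝔸]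
variable {S : Type*} [Fintype S] [DecidableEq S] {ι : Type*} [Fintype ι] [LinearOrder ι]
variable (T : ι → Equiv.Perm S) (U : ι → S → 𝔸ˣ)

/-- **(90), FIRST DISPLAY, IN COORDINATES**: `(∂/∂A(b))V₀(A)·X = η^d Σ_{p∈st(b)} (∂/∂A(b))V₀(A, ∂p)·X` for the one-bond variation at
`b = (μ₀, x₀)` (`B11Eq90V0Derivative.deriv_V0_line_eq_sum_of_subset` at `P := st(b)`). [cite: Balaban1985Variational, (90) p.291] -/
theorem deriv_V0_bond_eq_sum_st (τ : 𝔸 →L[ℂ] ℂ) (hτ : ∀ a b : 𝔸, τ (a * b) = τ (b * a)) {η : ℝ} (hη : η ≠ 0) {d : ℕ}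
    (hd : 4 ≤ d) (A : ι → S → 𝔸) (μ₀ : ι) (x₀ : S) (X : 𝔸) :
    deriv (fun t : ℂ => V0 T U η d (τ : 𝔸 →ₗ[ℂ] ℂ) (A + t • bondDelta μ₀ x₀ X)) 0
      = (η : ℂ) ^ d * ∑ q ∈ st T μ₀ x₀,
          deriv (fun t : ℂ => V0p T U η (τ : 𝔸 →ₗ[ℂ] ℂ) (A + t • bondDelta μ₀ x₀ X) q.2.1 q.2.2 q.1) 0 :=
  deriv_V0_line_eq_sum_of_subset T U τ hτ hη hd A (bondDelta μ₀ x₀ X) (st_subset_posPlaq T μ₀ x₀)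
    fun q hq hqP => lettersA_bondDelta_of_not_mem_st T U μ₀ x₀ X q hq hqP

/-- **THE V₀-GROUP BOUND PER BOND**: under the uniform majorants of `B11Eq90V0Derivative.norm_deriv_V0_line_le` on `st(b)`,
`|(∂/∂A(b))V₀(A)·X| ≦ η^d · 2(|ι| − 1) · (4/3)κη⁻¹s²e^{2ηs}·Δ` — print's «(∂/∂A(b))V′₀ … satisfies a bound … with the power of |A| lower by
1», in its V₀-form (bare `η⁻¹`, cf. `B11Eq90V0Derivative` §3), summed over the `2(d − 1)` plaquettes of `st(b)`.
[cite: Balaban1985Variational, (90) p.291] -/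
theorem norm_deriv_V0_bond_le (τ : 𝔸 →L[ℂ] ℂ) (hτ : ∀ a b : 𝔸, τ (a * b) = τ (b * a)) {η : ℝ} (hη : 0 < η) {d : ℕ}
    (hd : 4 ≤ d) (A : ι → S → 𝔸) (μ₀ : ι) (x₀ : S) (X : 𝔸) {s Δ κ : ℝ} (hs0 : 0 < s) (hΔ0 : 0 < Δ) (hκ0 : 0 ≤ κ)
    (hs : ∀ q ∈ st T μ₀ x₀, size (lettersA T U A q.2.1 q.2.2 q.1) ≤ s)
    (hΔ : ∀ q ∈ st T μ₀ x₀, size (lettersA T U (bondDelta μ₀ x₀ X) q.2.1 q.2.2 q.1) ≤ Δ)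
    (hκ : ∀ q ∈ st T μ₀ x₀,
      2⁻¹ * ‖τ‖ * (‖(plaqU T U q.2.1 q.2.2 q.1 : 𝔸)‖ + ‖(((plaqU T U q.2.1 q.2.2 q.1)⁻¹ : 𝔸ˣ) : 𝔸)‖) ≤ κ) :
    ‖deriv (fun t : ℂ => V0 T U η d (τ : 𝔸 →ₗ[ℂ] ℂ) (A + t • bondDelta μ₀ x₀ X)) 0‖
      ≤ η ^ d * ((2 * (Fintype.card ι - 1) : ℕ) * (4 / 3 * κ * η⁻¹ * s ^ 2 * Real.exp (2 * η * s) * Δ)) := by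
  refine (norm_deriv_V0_line_le T U τ hτ hη hd A (bondDelta μ₀ x₀ X) (st_subset_posPlaq T μ₀ x₀)
    (fun q hq hqP => lettersA_bondDelta_of_not_mem_st T U μ₀ x₀ X q hq hqP) hs0 hΔ0 hs hΔ hκ).trans ?_
  have hB : 0 ≤ 4 / 3 * κ * η⁻¹ * s ^ 2 * Real.exp (2 * η * s) * Δ := by positivity
  gcongr
  exact_mod_cast card_st_le T μ₀ x₀

end Bound

end Literature.MathematicalPhysics.QuantumFieldTheory.Balaban1983to89.B11Eq90StB
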